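import Mathlib
import Summits.PneNP.PneNP.Theorems.OverlapGapAlgebraNoStableSection

/-!
# Route OverlapGapAlgebra, crux `SearchHardWindow` (stmt-PneNP-2460): the MACRO-STEP path —
# the first moment of the two bad events, fixed `k`

Second file of the macro-step variant of `NoStableSection` (see `…SearchHardWindowMacroPath.lean`).
The glue of the `DartGame` line (`glue_fixed_k`, `…NoStableSectionGlue2.lean`) bounds the crux's
event only through the decomposition `StableValid ⊆ IndepBad ∪ OgpBad` and the two first moments
`glue_card_indepBad_le`, `glue_card_ogpBad_le` (`…NoStableSectionGlue1.lean`). Here the same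
first-moment estimate is recorded for the UNION OF THE TWO BAD EVENTS itself, for every section `g`:
`#{Ψ : IndepBad g ν bp Ψ ∨ OgpBad Ψ} ≤ e^{-(L/2) n} · #paths` eventually in `n`, under the
`k`-dependent parameter inequalities of `KACond`. The proof is that of `glue_fixed_k` verbatim with
step (1) replaced by the trivial union bound (adapted from the lead prover-line-stmt-PneNP-2462-0's
file; no new mathematics). Combined with `mns_ogpBad_of_macro` it gives the macro-step
`NoStableSection` (`…MacroNoStableSection.lean`).

References: G. Bresler, B. Huang, FOCS 2021 / arXiv:2106.02129, Prop. 4.7, §5 [BreslerHuang2022].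
-/

namespace Summit.PneNP.PneNP.Theorems

set_option linter.dupNamespace false -- `Summit.PneNP.PneNP.…`: summit = sub-problem (D-0017)

open Finset Real
open Summit.PneNP.PneNP.Cruxes.NoStableSection.DartGame

section FixedK

open Finset Filter Real
open scoped Classical Topology

variable {k m n : ℕ}

-- adapted from Summits/PneNP/PneNP/Theorems/OverlapGapAlgebraNoStableSectionGlue2.lean (glue_fixed_k)
set_option maxHeartbeats 400000 in
/-- **The first-moment estimate for a fixed `k`** (all `k`-dependent inequalities as hypotheses;
`n → ∞`): the union `IndepBad ∪ OgpBad` of the two bad events of the `DartGame` line has probability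
`≤ e^{-(L/2) n}` for EVERY section `g`. Verbatim the proof of `glue_fixed_k`
(`…NoStableSectionGlue2.lean`, lead prover-line-stmt-PneNP-2462-0) with the decomposition step
removed — that proof bounds `#StableValid` only through `#IndepBad + #OgpBad`.
[BreslerHuang2022, Prop. 4.7] -/
theorem mns_badCount_fixed_k (hC : CondEntCount)
    (hE : PathValidCount) (hF : IndepCount) (hEn : EnergyBound) (hk : 2 ≤ k)
    {η ν bm bp θ L α : ℝ} (hη0 : 0 < η) (hη2 : η ≤ 1 / 2) (hν0 : 0 < ν)
    (hνk : ((k : ℝ) + 1) * ν ≤ 1 / 2) (hwin : binEntropy η ≤ bp - bm) (hθ0 : 0 < θ)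
    (hθ1 : θ < 1) (hθb : 2 * θ ≤ bm) (hL : 0 < L) (hα : 0 < α)
    (hD0 : 0 ≤ (1 : ℝ) + k * (1 - (2 * (1 - (bm - 2 * θ) / (-Real.log θ)) ^ k +
      k * ((bm - 2 * θ) / (-Real.log θ)) * (1 - (bm - 2 * θ) / (-Real.log θ)) ^ (k - 1))) -
      θ * ((k : ℝ) * (k + 1) / 2))
    (hI : bp + α * binEntropy ν - (1 / 2 : ℝ) ^ k * (1 - ν) * α ≤ -(2 * L))
    (hO : Real.log 2 + k * bp + α * binEntropy (((k : ℝ) + 1) * ν) -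
      (1 / 2 : ℝ) ^ k * α * ((1 : ℝ) + k * (1 - (2 * (1 - (bm - 2 * θ) / (-Real.log θ)) ^ k +
      k * ((bm - 2 * θ) / (-Real.log θ)) * (1 - (bm - 2 * θ) / (-Real.log θ)) ^ (k - 1))) -
      θ * ((k : ℝ) * (k + 1) / 2)) * (1 - ((k : ℝ) + 1) * ν) ≤ -(2 * L)) :
    ∀ᶠ n : ℕ in atTop, ∀ m : ℕ, m = ⌊α * n⌋₊ → ∀ g : Inst m k n → Fin n → Bool,
      ((univ.filter fun Ψ : PathSp k m n => IndepBad g ν bp Ψ ∨ OgpBad k m n ν bm bp Ψ).card : ℝ) ≤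
        Real.exp (-(L / 2 * n)) * Fintype.card (PathSp k m n) := by
  -- abbreviations (made opaque: `clear_value`)
  set p₀ : ℝ := (bm - 2 * θ) / (-Real.log θ) with hp₀
  set D : ℝ := (1 : ℝ) + k * (1 - (2 * (1 - p₀) ^ k + k * p₀ * (1 - p₀) ^ (k - 1))) -
    θ * ((k : ℝ) * (k + 1) / 2) with hD
  clear_value p₀ D
  have hk1 : 1 ≤ k := by omega
  have hν1 : ν ≤ 1 / 2 := by
    have hk0 : (0 : ℝ) ≤ k := Nat.cast_nonneg k
    nlinarith
  have hνk0 : 0 ≤ 1 - ((k : ℝ) + 1) * ν := by linarith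
  have hbp : 0 ≤ bp := by linarith [binEntropy_nonneg hη0.le (by linarith : η ≤ 1)]
  have hhalf : (0 : ℝ) ≤ (1 / 2 : ℝ) ^ k := by positivity
  have hhalf1 : (1 / 2 : ℝ) ^ k ≤ 1 := pow_le_one₀ (by norm_num) (by norm_num)
  -- polynomial prefactors
  obtain ⟨A₁, hA₁⟩ : ∃ A₁ : ℝ, A₁ = ((k : ℝ) + 1) * ((k : ℝ) ^ 2 * α + 1) ^ (k + 1) * Real.exp 1 :=
    ⟨_, rfl⟩
  obtain ⟨A₂, hA₂⟩ : ∃ A₂ : ℝ, A₂ = ((k : ℝ) ^ 2 * α + 1) ^ (k + 1) * Real.exp (D * (k + 2)) :=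
    ⟨_, rfl⟩
  have ev1 := glue_poly_le_exp_eventually (k + 1 + 2 ^ k) A₁ L hL
  have ev2 := glue_poly_le_exp_eventually (k + 1 + k * 2 ^ k) A₂ L hL
  -- `m` large
  have ev3 : ∀ᶠ n : ℕ in atTop, (2 * ((k : ℝ) + 1) + 2) ≤ α * n - 1 := by
    have ht : Tendsto (fun n : ℕ => α * n - 1) atTop atTop :=
      tendsto_atTop_add_const_right _ _ (Tendsto.const_mul_atTop hα tendsto_natCast_atTop_atTop)
    exact ht.eventually_ge_atTop _
  -- `2 e^{-L n} ≤ e^{-(L/2) n}`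
  have ev4 : ∀ᶠ n : ℕ in atTop, Real.log 2 ≤ L / 2 * n := by
    have ht : Tendsto (fun n : ℕ => L / 2 * n) atTop atTop :=
      Tendsto.const_mul_atTop (half_pos hL) tendsto_natCast_atTop_atTop
    exact ht.eventually_ge_atTop _
  filter_upwards [ev1, ev2, ev3, ev4] with n hn1 hn2 hn3 hn4 m hm g
  -- facts about `m`
  have hnn : (0 : ℝ) ≤ n := Nat.cast_nonneg n
  have hαn : 0 ≤ α * n := by positivity
  have hm_le : (m : ℝ) ≤ α * n := by rw [hm]; exact Nat.floor_le hαn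
  have hm_ge : α * n - 1 ≤ m := by rw [hm]; exact (Nat.sub_one_lt_floor _).le
  have hm2 : 2 * ((k : ℝ) + 1) + 2 ≤ m := hn3.trans hm_ge
  have hk0 : (0 : ℝ) ≤ k := Nat.cast_nonneg k
  have hm0 : (0 : ℝ) ≤ m := Nat.cast_nonneg m
  have hm1 : 1 ≤ m := by
    have : (1 : ℝ) ≤ m := by linarith
    exact_mod_cast this
  have hn1' : 1 ≤ n := by
    rcases Nat.eq_zero_or_pos n with hn0 | h
    · exfalso
      rw [hn0] at hn3
      simp only [Nat.cast_zero, mul_zero, zero_sub] at hn3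
      linarith
    · exact h
  have hW : 0 < m * k := Nat.mul_pos (by omega) (by omega)
  have hJle : (⌊ν * (m : ℝ)⌋₊ : ℝ) ≤ ν * m := Nat.floor_le (by positivity)
  have hkJ : ((k : ℝ) + 1) * ⌊ν * (m : ℝ)⌋₊ ≤ (m : ℝ) / 2 := by
    calc ((k : ℝ) + 1) * ⌊ν * (m : ℝ)⌋₊ ≤ ((k : ℝ) + 1) * (ν * m) :=
          mul_le_mul_of_nonneg_left hJle (by positivity)
      _ = (((k : ℝ) + 1) * ν) * m := by ring
      _ ≤ (1 / 2) * m := mul_le_mul_of_nonneg_right hνk hm0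
      _ = m / 2 := by ring
  have hslots : 0 ≤ (m : ℝ) - (k + 1) * ⌊ν * (m : ℝ)⌋₊ - (k + 1) := by linarith
  -- (1) the union bound: `#(IB ∪ OB) ≤ #IB + #OB`
  have hdec : ((univ.filter fun Ψ : PathSp k m n =>
      IndepBad g ν bp Ψ ∨ OgpBad k m n ν bm bp Ψ).card : ℝ) ≤
      ((univ.filter fun Ψ : PathSp k m n => IndepBad g ν bp Ψ).card : ℝ) +
      ((univ.filter fun Ψ : PathSp k m n => OgpBad k m n ν bm bp Ψ).card : ℝ) := by
    have hsub : (univ.filter fun Ψ : PathSp k m n => IndepBad g ν bp Ψ ∨ OgpBad k m n ν bm bp Ψ) ⊆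
        (univ.filter fun Ψ : PathSp k m n => IndepBad g ν bp Ψ) ∪
        (univ.filter fun Ψ : PathSp k m n => OgpBad k m n ν bm bp Ψ) := by
      intro Ψ hΨ
      simp only [mem_filter, mem_univ, true_and, mem_union] at hΨ ⊢
      exact hΨ
    calc ((univ.filter fun Ψ : PathSp k m n => IndepBad g ν bp Ψ ∨ OgpBad k m n ν bm bp Ψ).card : ℝ)
        ≤ (((univ.filter fun Ψ : PathSp k m n => IndepBad g ν bp Ψ) ∪
            (univ.filter fun Ψ : PathSp k m n => OgpBad k m n ν bm bp Ψ)).card : ℝ) := by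
          exact_mod_cast card_le_card hsub
      _ ≤ _ := by exact_mod_cast card_union_le _ _
  -- (2) the energy bound for admissible ladders
  have hDY : ∀ Y : Fin (k + 1) → Fin n → Bool,
      (∀ ℓ : Fin (k + 1), 1 ≤ (ℓ : ℕ) → condEnt (seqOf Y) ℓ ∈ Set.Icc bm bp) →
      D ≤ (energySum (seqOf Y) k : ℝ) / (n : ℝ) ^ k := by
    intro Y hY
    rw [hD]
    refine hEn n k (seqOf Y) θ bm p₀ hn1' hk1 hθ0 hθ1 hθb hp₀ fun ℓ hℓ1 hℓk => ?_
    have := hY ⟨ℓ, Nat.lt_succ_of_le hℓk⟩ hℓ1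
    exact this.1
  -- (3) the two first moments
  have hIB := glue_card_indepBad_le (k := k) (m := m) hC hF hn1' g (bp := bp) hν0.le
  have hOB := glue_card_ogpBad_le (k := k) (m := m) hC hE hn1' hν0.le hbp hD0 hslots hDY
  set J : ℕ := ⌊ν * (m : ℝ)⌋₊ with hJ
  clear_value J
  have hJm : J ≤ m := by
    have h : (J : ℝ) ≤ (m : ℝ) := by
      calc (J : ℝ) ≤ ν * m := hJle
        _ ≤ 1 * m := mul_le_mul_of_nonneg_right (by linarith) hm0
        _ = m := one_mul _
    exact_mod_cast h
  -- (4) the real-analysis bounds on the factors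
  set P : ℝ := (Fintype.card (PathSp k m n) : ℝ) with hP
  clear_value P
  have hP0 : 0 ≤ P := by rw [hP]; positivity
  have hTle : ((k * (m * k) : ℕ) + 1 : ℝ) ≤ ((k : ℝ) ^ 2 * α + 1) * ((n : ℝ) + 2) := by
    have h1 : ((k * (m * k) : ℕ) : ℝ) = (k : ℝ) ^ 2 * m := by push_cast; ring
    have h2 : (k : ℝ) ^ 2 * m ≤ (k : ℝ) ^ 2 * (α * n) :=
      mul_le_mul_of_nonneg_left hm_le (sq_nonneg _)
    have h3 : 0 ≤ (k : ℝ) ^ 2 * α := by positivity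
    have h4 : ((k : ℝ) ^ 2 * α + 1) * ((n : ℝ) + 2) =
        (k : ℝ) ^ 2 * (α * n) + 2 * ((k : ℝ) ^ 2 * α) + n + 2 := by ring
    rw [h1, h4]
    linarith
  have hT0 : (0 : ℝ) ≤ ((k * (m * k) : ℕ) + 1 : ℝ) := by positivity
  have hn12 : ((n : ℝ) + 1) ≤ (n : ℝ) + 2 := by linarith
  -- binomial sums
  have hN₁ : ∑ j ∈ range (J + 1), (m.choose j : ℝ) ≤ Real.exp (m * binEntropy ν) :=
    glue_sum_choose_le m hν0.le hν1 (by rw [hJ])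
  have hN₂ : ∑ j ∈ range ((k + 1) * J + 1), (m.choose j : ℝ) ≤
      Real.exp (m * binEntropy (((k : ℝ) + 1) * ν)) := by
    refine glue_sum_choose_le m (by positivity) hνk (Nat.le_floor ?_)
    push_cast
    rw [mul_assoc]
    exact mul_le_mul_of_nonneg_left hJle (by positivity)
  have hpowJ : (1 - (1 / 2 : ℝ) ^ k) ^ (m - J) ≤ Real.exp (-((1 / 2 : ℝ) ^ k * ((1 - ν) * m))) := by
    refine (glue_one_sub_pow_le hhalf hhalf1 (m - J)).trans (Real.exp_le_exp.2 (neg_le_neg ?_))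
    refine mul_le_mul_of_nonneg_left ?_ hhalf
    rw [Nat.cast_sub hJm]
    linarith
  -- entropy terms: `m H ≤ α n H`
  have hH1 : (m : ℝ) * binEntropy ν ≤ α * n * binEntropy ν :=
    mul_le_mul_of_nonneg_right hm_le (binEntropy_nonneg hν0.le (by linarith))
  have hH2 : (m : ℝ) * binEntropy (((k : ℝ) + 1) * ν) ≤ α * n * binEntropy (((k : ℝ) + 1) * ν) :=
    mul_le_mul_of_nonneg_right hm_le (binEntropy_nonneg (by positivity) (by linarith))
  -- (5) the `S_indep` total
  have hIBtot : ((univ.filter fun Ψ : PathSp k m n => IndepBad g ν bp Ψ).card : ℝ) ≤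
      Real.exp (-(L * n)) * P := by
    refine hIB.trans ?_
    -- the four `n`-dependent factors
    have hF1 : ((n : ℝ) + 1) ^ (2 ^ k) ≤ ((n : ℝ) + 2) ^ (2 ^ k) :=
      pow_le_pow_left₀ (by positivity) hn12 _
    have h4pos : 0 ≤ (1 - (1 / 2 : ℝ) ^ k) ^ (m - J) := pow_nonneg (by linarith) _
    have hprod : ((n : ℝ) + 1) ^ (2 ^ k) * Real.exp (n * bp) *
        (∑ j ∈ range (J + 1), (m.choose j : ℝ)) * (1 - (1 / 2 : ℝ) ^ k) ^ (m - J) ≤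
        ((n : ℝ) + 2) ^ (2 ^ k) * Real.exp (n * bp) * Real.exp (m * binEntropy ν) *
          Real.exp (-((1 / 2 : ℝ) ^ k * ((1 - ν) * m))) := by
      have h12 : ((n : ℝ) + 1) ^ (2 ^ k) * Real.exp (n * bp) ≤
          ((n : ℝ) + 2) ^ (2 ^ k) * Real.exp (n * bp) :=
        mul_le_mul_of_nonneg_right hF1 (Real.exp_nonneg _)
      have h123 := mul_le_mul h12 hN₁ (by positivity) (by positivity)
      exact mul_le_mul h123 hpowJ h4pos (by positivity)
    have hexp : Real.exp (n * bp) * Real.exp (m * binEntropy ν) *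
        Real.exp (-((1 / 2 : ℝ) ^ k * ((1 - ν) * m))) ≤ Real.exp 1 * Real.exp (-(2 * L) * n) := by
      rw [← Real.exp_add, ← Real.exp_add, ← Real.exp_add]
      refine Real.exp_le_exp.2 ?_
      have h1 : (1 / 2 : ℝ) ^ k * ((1 - ν) * (α * n - 1)) ≤ (1 / 2 : ℝ) ^ k * ((1 - ν) * m) :=
        mul_le_mul_of_nonneg_left (mul_le_mul_of_nonneg_left hm_ge (by linarith)) hhalf
      have h2 : (1 / 2 : ℝ) ^ k * (1 - ν) ≤ 1 := mul_le_one₀ hhalf1 (by linarith) (by linarith)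
      have h3 := mul_le_mul_of_nonneg_right hI hnn
      linarith
    have hpre : ((k : ℝ) + 1) * ((k * (m * k) : ℕ) + 1 : ℝ) ^ (k + 1) * ((n : ℝ) + 2) ^ (2 ^ k) *
        Real.exp 1 ≤ A₁ * ((n : ℝ) + 2) ^ (k + 1 + 2 ^ k) := by
      have hT' : ((k * (m * k) : ℕ) + 1 : ℝ) ^ (k + 1) ≤
          (((k : ℝ) ^ 2 * α + 1) * ((n : ℝ) + 2)) ^ (k + 1) := pow_le_pow_left₀ hT0 hTle _
      calc ((k : ℝ) + 1) * ((k * (m * k) : ℕ) + 1 : ℝ) ^ (k + 1) * ((n : ℝ) + 2) ^ (2 ^ k) *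
            Real.exp 1
          ≤ ((k : ℝ) + 1) * (((k : ℝ) ^ 2 * α + 1) * ((n : ℝ) + 2)) ^ (k + 1) *
            ((n : ℝ) + 2) ^ (2 ^ k) * Real.exp 1 := by
            have := mul_le_mul_of_nonneg_left hT' (by positivity : (0 : ℝ) ≤ (k : ℝ) + 1)
            exact mul_le_mul_of_nonneg_right (mul_le_mul_of_nonneg_right this (by positivity))
              (Real.exp_nonneg _)
        _ = A₁ * ((n : ℝ) + 2) ^ (k + 1 + 2 ^ k) := by rw [hA₁, mul_pow, pow_add]; ring
    calc ((k : ℝ) + 1) * ((k * (m * k) : ℕ) + 1 : ℝ) ^ (k + 1) *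
          (((n : ℝ) + 1) ^ (2 ^ k) * Real.exp (n * bp) *
            (∑ j ∈ range (J + 1), (m.choose j : ℝ)) * (1 - (1 / 2 : ℝ) ^ k) ^ (m - J) * P)
        ≤ ((k : ℝ) + 1) * ((k * (m * k) : ℕ) + 1 : ℝ) ^ (k + 1) *
          (((n : ℝ) + 2) ^ (2 ^ k) * (Real.exp 1 * Real.exp (-(2 * L) * n)) * P) := by
          refine mul_le_mul_of_nonneg_left ?_ (by positivity)
          refine mul_le_mul_of_nonneg_right ?_ hP0
          calc ((n : ℝ) + 1) ^ (2 ^ k) * Real.exp (n * bp) *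
                (∑ j ∈ range (J + 1), (m.choose j : ℝ)) * (1 - (1 / 2 : ℝ) ^ k) ^ (m - J)
              ≤ ((n : ℝ) + 2) ^ (2 ^ k) * Real.exp (n * bp) * Real.exp (m * binEntropy ν) *
                Real.exp (-((1 / 2 : ℝ) ^ k * ((1 - ν) * m))) := hprod
            _ = ((n : ℝ) + 2) ^ (2 ^ k) * (Real.exp (n * bp) * Real.exp (m * binEntropy ν) *
                Real.exp (-((1 / 2 : ℝ) ^ k * ((1 - ν) * m)))) := by ring
            _ ≤ ((n : ℝ) + 2) ^ (2 ^ k) * (Real.exp 1 * Real.exp (-(2 * L) * n)) :=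
                mul_le_mul_of_nonneg_left hexp (by positivity)
      _ = ((k : ℝ) + 1) * ((k * (m * k) : ℕ) + 1 : ℝ) ^ (k + 1) * ((n : ℝ) + 2) ^ (2 ^ k) *
          Real.exp 1 * (Real.exp (-(2 * L) * n) * P) := by ring
      _ ≤ A₁ * ((n : ℝ) + 2) ^ (k + 1 + 2 ^ k) * (Real.exp (-(2 * L) * n) * P) :=
          mul_le_mul_of_nonneg_right hpre (by positivity)
      _ ≤ Real.exp (L * n) * (Real.exp (-(2 * L) * n) * P) :=
          mul_le_mul_of_nonneg_right hn1 (by positivity)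
      _ = Real.exp (-(L * n)) * P := by rw [← mul_assoc, ← Real.exp_add]; ring_nf
  -- (6) the `S_ogp` total (big sub-expressions made opaque)
  obtain ⟨Tf, hTf⟩ : ∃ x : ℝ, x = ((k * (m * k) : ℕ) + 1 : ℝ) ^ (k + 1) := ⟨_, rfl⟩
  obtain ⟨F, hFd⟩ : ∃ x : ℝ, x = (2 : ℝ) ^ n * (((n : ℝ) + 1) ^ (2 ^ k) * Real.exp (n * bp)) ^ k :=
    ⟨_, rfl⟩
  obtain ⟨G, hGd⟩ : ∃ x : ℝ, x = (∑ j ∈ range ((k + 1) * J + 1), (m.choose j : ℝ)) *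
      Real.exp (-((1 / 2 : ℝ) ^ k * D * ((m : ℝ) - (k + 1) * J - (k + 1)))) := ⟨_, rfl⟩
  obtain ⟨F', hF'd⟩ : ∃ x : ℝ, x = Real.exp (n * Real.log 2) *
      (((n : ℝ) + 2) ^ (k * 2 ^ k) * Real.exp (k * (n * bp))) := ⟨_, rfl⟩
  obtain ⟨G', hG'd⟩ : ∃ x : ℝ, x = Real.exp (m * binEntropy (((k : ℝ) + 1) * ν)) *
      Real.exp (-((1 / 2 : ℝ) ^ k * D * ((1 - ((k : ℝ) + 1) * ν) * m - (k + 1)))) := ⟨_, rfl⟩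
  have hOB' : ((univ.filter fun Ψ : PathSp k m n => OgpBad k m n ν bm bp Ψ).card : ℝ) ≤
      Tf * F * (G * P) := by rw [hTf, hFd, hGd]; exact hOB
  have hF0 : 0 ≤ F := by rw [hFd]; positivity
  have hG0 : 0 ≤ G := by rw [hGd]; positivity
  have hTf0 : 0 ≤ Tf := by rw [hTf]; positivity
  have h2n : (2 : ℝ) ^ n = Real.exp (n * Real.log 2) := by
    rw [Real.exp_nat_mul, Real.exp_log two_pos]
  have hFF' : F ≤ F' := by
    rw [hFd, hF'd, h2n]
    refine mul_le_mul_of_nonneg_left ?_ (Real.exp_nonneg _)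
    calc (((n : ℝ) + 1) ^ (2 ^ k) * Real.exp (n * bp)) ^ k
        ≤ (((n : ℝ) + 2) ^ (2 ^ k) * Real.exp (n * bp)) ^ k :=
          pow_le_pow_left₀ (by positivity)
            (mul_le_mul_of_nonneg_right (pow_le_pow_left₀ (by positivity) hn12 _)
              (Real.exp_nonneg _)) _
      _ = ((n : ℝ) + 2) ^ (k * 2 ^ k) * Real.exp (k * (n * bp)) := by
          rw [mul_pow, ← Real.exp_nat_mul, pow_mul', ← pow_mul, mul_comm (2 ^ k) k]
  have hGG' : G ≤ G' := by
    rw [hGd, hG'd]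
    refine mul_le_mul hN₂ (Real.exp_le_exp.2 (neg_le_neg ?_)) (Real.exp_nonneg _) (Real.exp_nonneg _)
    refine mul_le_mul_of_nonneg_left ?_ (mul_nonneg hhalf hD0)
    linarith [mul_le_mul_of_nonneg_left hJle (by positivity : (0 : ℝ) ≤ (k : ℝ) + 1)]
  have hexp : F' * G' ≤ ((n : ℝ) + 2) ^ (k * 2 ^ k) * (Real.exp (D * (k + 2)) *
      Real.exp (-(2 * L) * n)) := by
    have hFG' : F' * G' = ((n : ℝ) + 2) ^ (k * 2 ^ k) * Real.exp (n * Real.log 2 + k * (n * bp) +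
        (m * binEntropy (((k : ℝ) + 1) * ν) +
          -((1 / 2 : ℝ) ^ k * D * ((1 - ((k : ℝ) + 1) * ν) * m - (k + 1))))) := by
      rw [hF'd, hG'd, Real.exp_add, Real.exp_add, Real.exp_add]; ring
    rw [hFG', ← Real.exp_add]
    refine mul_le_mul_of_nonneg_left (Real.exp_le_exp.2 ?_) (by positivity)
    have h1 : (1 / 2 : ℝ) ^ k * D * ((1 - ((k : ℝ) + 1) * ν) * (α * n - 1) - (k + 1)) ≤
        (1 / 2 : ℝ) ^ k * D * ((1 - ((k : ℝ) + 1) * ν) * m - (k + 1)) := by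
      refine mul_le_mul_of_nonneg_left ?_ (mul_nonneg hhalf hD0)
      linarith [mul_le_mul_of_nonneg_left hm_ge hνk0]
    have h2 : (1 / 2 : ℝ) ^ k * D * ((1 - ((k : ℝ) + 1) * ν) + (k + 1)) ≤ D * (k + 2) := by
      have h21 : (1 / 2 : ℝ) ^ k * D ≤ D := mul_le_of_le_one_left hD0 hhalf1
      have h22 : (1 - ((k : ℝ) + 1) * ν) + (k + 1) ≤ (k : ℝ) + 2 := by
        have : 0 ≤ ((k : ℝ) + 1) * ν := by positivity
        linarith
      calc (1 / 2 : ℝ) ^ k * D * ((1 - ((k : ℝ) + 1) * ν) + (k + 1))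
          ≤ D * ((1 - ((k : ℝ) + 1) * ν) + (k + 1)) :=
            mul_le_mul_of_nonneg_right h21 (by linarith)
        _ ≤ D * ((k : ℝ) + 2) := mul_le_mul_of_nonneg_left h22 hD0
    have h3 := mul_le_mul_of_nonneg_right hO hnn
    linarith
  have hpre : Tf * ((n : ℝ) + 2) ^ (k * 2 ^ k) * Real.exp (D * (k + 2)) ≤
      A₂ * ((n : ℝ) + 2) ^ (k + 1 + k * 2 ^ k) := by
    have hT' : Tf ≤ (((k : ℝ) ^ 2 * α + 1) * ((n : ℝ) + 2)) ^ (k + 1) := by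
      rw [hTf]; exact pow_le_pow_left₀ hT0 hTle _
    calc Tf * ((n : ℝ) + 2) ^ (k * 2 ^ k) * Real.exp (D * (k + 2))
        ≤ (((k : ℝ) ^ 2 * α + 1) * ((n : ℝ) + 2)) ^ (k + 1) * ((n : ℝ) + 2) ^ (k * 2 ^ k) *
          Real.exp (D * (k + 2)) :=
          mul_le_mul_of_nonneg_right (mul_le_mul_of_nonneg_right hT' (by positivity))
            (Real.exp_nonneg _)
      _ = A₂ * ((n : ℝ) + 2) ^ (k + 1 + k * 2 ^ k) := by rw [hA₂, mul_pow, pow_add]; ring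
  have hOBtot : ((univ.filter fun Ψ : PathSp k m n => OgpBad k m n ν bm bp Ψ).card : ℝ) ≤
      Real.exp (-(L * n)) * P := by
    have hFG : F * G ≤ F' * G' := mul_le_mul hFF' hGG' hG0 (hF0.trans hFF')
    calc ((univ.filter fun Ψ : PathSp k m n => OgpBad k m n ν bm bp Ψ).card : ℝ)
        ≤ Tf * F * (G * P) := hOB'
      _ = Tf * (F * G) * P := by ring
      _ ≤ Tf * (((n : ℝ) + 2) ^ (k * 2 ^ k) * (Real.exp (D * (k + 2)) *
          Real.exp (-(2 * L) * n))) * P :=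
          mul_le_mul_of_nonneg_right (mul_le_mul_of_nonneg_left (hFG.trans hexp) hTf0) hP0
      _ = Tf * ((n : ℝ) + 2) ^ (k * 2 ^ k) * Real.exp (D * (k + 2)) *
          (Real.exp (-(2 * L) * n) * P) := by ring
      _ ≤ A₂ * ((n : ℝ) + 2) ^ (k + 1 + k * 2 ^ k) * (Real.exp (-(2 * L) * n) * P) :=
          mul_le_mul_of_nonneg_right hpre (by positivity)
      _ ≤ Real.exp (L * n) * (Real.exp (-(2 * L) * n) * P) :=
          mul_le_mul_of_nonneg_right hn2 (by positivity)
      _ = Real.exp (-(L * n)) * P := by rw [← mul_assoc, ← Real.exp_add]; ring_nf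
  -- (7) conclude
  have hfin : 2 * Real.exp (-(L * n)) ≤ Real.exp (-(L / 2 * n)) := by
    have h := mul_le_mul_of_nonneg_right (Real.exp_le_exp.2 hn4) (Real.exp_nonneg (-(L * n)))
    rw [Real.exp_log two_pos, ← Real.exp_add] at h
    have he : L / 2 * n + -(L * n) = -(L / 2 * n) := by ring
    rwa [he] at h
  calc ((univ.filter fun Ψ : PathSp k m n => IndepBad g ν bp Ψ ∨ OgpBad k m n ν bm bp Ψ).card : ℝ)
      ≤ Real.exp (-(L * n)) * P + Real.exp (-(L * n)) * P := hdec.trans (add_le_add hIBtot hOBtot)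
    _ = 2 * Real.exp (-(L * n)) * P := by ring
    _ ≤ Real.exp (-(L / 2 * n)) * P := mul_le_mul_of_nonneg_right hfin hP0


end FixedK

end Summit.PneNP.PneNP.Theorems
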